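import Summits.CriticalPhenomena.PercolationContinuityZ3.Theorems.PercNearOneGluingNoHeavyLowerTailThreePointVarianceTwoNeighbourWalks
import Summits.CriticalPhenomena.PercolationContinuityZ3.Theorems.PercNearOneGluingNoHeavyLowerTailThreePointVarianceTwoNeighbourCube
import Summits.CriticalPhenomena.PercolationContinuityZ3.Theorems.PercNearOneGluingNoHeavyLowerTailThreePointVarianceTwoNeighbourTools
import Literature.Probability.LatticeModels.ProdBernoulliClusterLocality
import HarnessLib

/-!
# The two-neighbour reduction for `(3PT)` — assembly on `prodBernoulli`

Support file for crux `stmt-CriticalPhenomena-4575` (`NoHeavyLowerTail`), seat `prim-l12-p1` gen 18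
(`--supports stmt-CriticalPhenomena-4575`).  Memo `run/shared/lean/prim/prim-l12/FROM-prim-l12-p1-g18-FACET-PRINCIPLE.md` §4.6.

THEOREM (`threePointVariance_twoNeighbour_reduction`).  Bond percolation `prodBernoulli w` on the pairs of `Fin n`,
vertices `a b c v d` with `c ∉ {a,b,v,d}`, `v ≠ d`, and every pair `s(c,x)` with `x ∉ {v,d}` of weight `0` (so `c` has
at most the two neighbours `v, d`).  If the three-point variance row
`(3PT)  P(a↔b)·P(a↮b) ≤ P(a↔b, a↮c) + P(a↔c, a↮b) + P(b↔c, a↮b)`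
holds for the four one-parameter families of weights obtained from `w` by setting `(w(cv), w(cd))` to `(t,0)`, `(t,1)`,
`(0,t)`, `(1,t)` (`t ∈ [0,1]`) — i.e. for the graphs `G − cd`, `G/cd`, `G − cv`, `G/cv` — then it holds for `w`.
Consequently a counterexample to `(3PT)` with the fewest vertices has `deg c ≥ 3`, and `(3PT)` holds on every graph whose
vertices other than `a, b` have degree `≤ 2` (memo §4.6; these corollaries are not formalised here).

Proof: the one-bond decomposition (`stub_oneBondDecomp_k15`, twice) makes every probability bilinear in
`(r,ρ) = (w(cv), w(cd))`; the walk lemmas (`…TwoNeighbourWalks`) identify the corner values — `P(a↔b)` equals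
`θ₀ = P(R)` (`R = {a↔b avoiding c}`) unless both pairs are open, `P(U) = θ₀` when `c` is isolated, and
`P_{(1,0)}(U) ≥ P_{(1,1)}(a↔b) − θ₀` (a crossing configuration with one open pair lies in `U`); then
`…TwoNeighbourCube.fp0_two` (the maximum principle `FP₀(2)`) concludes. [this work]
-/

namespace Summit.CriticalPhenomena.PercolationContinuityZ3.Theorems.ThreePointVarianceTwoNeighbourReduction

open MeasureTheory Set
open Literature.Probability.Percolation Literature.Probability.LatticeModels
open Summit.CriticalPhenomena.PercolationContinuityZ3.Theorems
open Summit.CriticalPhenomena.PercolationContinuityZ3.Theorems.ThreePointVarianceTwoNeighbours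
open Summit.CriticalPhenomena.PercolationContinuityZ3.Theorems.ThreePointVarianceTwoNeighbourWalks
open Summit.CriticalPhenomena.PercolationContinuityZ3.Theorems.ThreePointVarianceTwoNeighbourCube
open Summit.CriticalPhenomena.PercolationContinuityZ3.Theorems.ThreePointVarianceTwoNeighbourTools

variable {n : ℕ}

section corners
variable {a b c v d : Fin n}

/-- **Corner `Θ`: one usable neighbour does not create `a ↔ b`.**  If the pairs `s(c,x)`, `x ∉ {v,d}`, have weight
`0` and `s(c,d)` has weight `0`, then `P(a↔b) = P(a↔b avoiding c)`. [this work] -/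
theorem real_ab_eq_R (w' : Sym2 (Fin n) → unitInterval) (hac : a ≠ c) (hbc : b ≠ c)
    (hw : ∀ x, x ≠ v → x ≠ d → (w' s(c, x) : ℝ) = 0) (hd : (w' s(c, d) : ℝ) = 0) :
    (prodBernoulli w').real (openConn a b) = (prodBernoulli w').real (reachOff c a b) := by
  have hN := real_union_null w' (real_badvd w' hw) (real_mem_of_zero w' hd)
  refine real_eq_of_agree_off_null w' hN fun ω hω => ?_
  simp only [mem_union, mem_setOf_eq, not_or, not_exists, not_and] at hω
  have hnb : ∀ x, s(c, x) ∈ ω → x = v ∨ x = d := by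
    intro x hx
    by_contra hcon
    rw [not_or] at hcon
    exact hω.1 x hcon.1 hcon.2 hx
  exact ab_iff_R_of_closed hac hbc hnb hω.2

/-- **Corner `(1,1)` bound.**  If the pairs `s(c,x)`, `x ∉ {v,d}`, have weight `0`, then
`P(a↔b) ≤ P(R) + P(X')` with `X'` the crossing event without `R`. [this work] -/
theorem real_ab_le_R_add_cross (w' : Sym2 (Fin n) → unitInterval) (hac : a ≠ c) (hbc : b ≠ c)
    (hw : ∀ x, x ≠ v → x ≠ d → (w' s(c, x) : ℝ) = 0) :
    (prodBernoulli w').real (openConn a b) ≤ (prodBernoulli w').real (reachOff c a b) +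
      (prodBernoulli w').real (((reachOff c a v ∩ reachOff c b d) ∪ (reachOff c a d ∩ reachOff c b v)) ∩ (reachOff c a b)ᶜ) := by
  have hN := real_badvd w' hw
  have h1 : (prodBernoulli w').real (openConn a b) ≤ (prodBernoulli w').real (reachOff c a b ∪
      (((reachOff c a v ∩ reachOff c b d) ∪ (reachOff c a d ∩ reachOff c b v)) ∩ (reachOff c a b)ᶜ)) := by
    refine real_le_of_subset_off_null w' hN fun ω hω hab => ?_
    simp only [mem_setOf_eq, not_exists, not_and] at hω
    have hnb : ∀ x, s(c, x) ∈ ω → x = v ∨ x = d := by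
      intro x hx
      by_contra hcon
      rw [not_or] at hcon
      exact hω x hcon.1 hcon.2 hx
    by_cases hR : ω ∈ reachOff c a b
    · exact Or.inl hR
    · rcases ab_subset_R_union_cross hac hbc hnb hab with h | h
      · exact (hR h).elim
      · exact Or.inr ⟨h, hR⟩
  exact h1.trans (measureReal_union_le _ _)

/-- **Corner `(1,0)`: a crossing configuration lies in `U`.**  If the pairs `s(c,x)`, `x ∉ {v,d}`, have weight `0`,
`s(c,v)` has weight `1` and `s(c,d)` weight `0`, then `P(X') ≤ P(a↔c, a↮b) + P(b↔c, a↮b)`. [this work] -/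
theorem real_cross_le_cells (w' : Sym2 (Fin n) → unitInterval) (hac : a ≠ c) (hbc : b ≠ c) (hvc : v ≠ c)
    (hw : ∀ x, x ≠ v → x ≠ d → (w' s(c, x) : ℝ) = 0) (hv : (w' s(c, v) : ℝ) = 1) (hd : (w' s(c, d) : ℝ) = 0) :
    (prodBernoulli w').real (((reachOff c a v ∩ reachOff c b d) ∪ (reachOff c a d ∩ reachOff c b v)) ∩ (reachOff c a b)ᶜ) ≤
      (prodBernoulli w').real (openConn a c ∩ (openConn a b)ᶜ) + (prodBernoulli w').real (openConn b c ∩ (openConn a b)ᶜ) := by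
  have hN := real_union_null w' (real_union_null w' (real_badvd w' hw) (real_mem_of_zero w' hd)) (real_notMem_of_one w' hv)
  have h1 : (prodBernoulli w').real (((reachOff c a v ∩ reachOff c b d) ∪ (reachOff c a d ∩ reachOff c b v)) ∩ (reachOff c a b)ᶜ)
      ≤ (prodBernoulli w').real ((openConn a c ∩ (openConn a b)ᶜ) ∪ (openConn b c ∩ (openConn a b)ᶜ)) := by
    refine real_le_of_subset_off_null w' hN fun ω hω hX => ?_
    simp only [mem_union, mem_setOf_eq, not_or, not_exists, not_and, not_not] at hω
    obtain ⟨⟨hbad, hdc⟩, hvo⟩ := hω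
    have hnb : ∀ x, s(c, x) ∈ ω → x = v ∨ x = d := by
      intro x hx
      by_contra hcon
      rw [not_or] at hcon
      exact hbad x hcon.1 hcon.2 hx
    obtain ⟨hX1, hR⟩ := hX
    rcases hX1 with ⟨hav, -⟩ | ⟨-, hbv⟩
    · exact Or.inl (cell_ac_of_cross hac hbc hvc hnb hvo hdc hR hav)
    · exact Or.inr (cell_bc_of_cross hac hbc hvc hnb hvo hdc hR hbv)
  exact h1.trans (measureReal_union_le _ _)

/-- **Corner `(0,0)`: `c` isolated.**  If every pair at `c` has weight `0` then `P(a↔c) = 0` (`a ≠ c`). [this work] -/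
theorem real_ac_zero (w' : Sym2 (Fin n) → unitInterval) (hac : a ≠ c) (hw : ∀ x, (w' s(c, x) : ℝ) = 0) :
    (prodBernoulli w').real (openConn a c) = 0 := by
  classical
  -- null set: some pair at `c` open
  have hN : (prodBernoulli w').real {ω : BondConfig (Fin n) | ∃ x, x ≠ c ∧ x ≠ c ∧ s(c, x) ∈ ω} = 0 :=
    real_badvd (v := c) (d := c) w' fun x hx _ => hw x
  have hloop : (prodBernoulli w').real {ω : BondConfig (Fin n) | s(c, c) ∈ ω} = 0 := real_mem_of_zero w' (hw c)
  have hN' := real_union_null w' hN hloop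
  refine le_antisymm ((measureReal_mono (fun ω hω => ?_)).trans (le_of_eq hN')) measureReal_nonneg
  show ω ∈ {ω : BondConfig (Fin n) | ∃ x, x ≠ c ∧ x ≠ c ∧ s(c, x) ∈ ω} ∪ {ω | s(c, c) ∈ ω}
  by_contra hcon
  simp only [mem_union, mem_setOf_eq, not_or, not_exists, not_and] at hcon
  have hno : ∀ x, s(c, x) ∉ ω := by
    intro x hx
    by_cases hxc : x = c
    · subst hxc; exact hcon.2 hx
    · exact hcon.1 x hxc hxc hx
  exact not_ac_of_isolated hac hno hω

end corners

/-! ### The reduction theorem -/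

/-- **The two-neighbour reduction for `(3PT)` (all `n`).**  Let `c ∉ {a,b,v,d}`, `v ≠ d`, and let every pair `s(c,x)`
with `x ∉ {v,d}` have weight `0`.  If `(3PT)` holds for the weights `w[cv ↦ t][cd ↦ 0]`, `w[cv ↦ t][cd ↦ 1]`,
`w[cv ↦ 0][cd ↦ t]`, `w[cv ↦ 1][cd ↦ t]` for every `t ∈ [0,1]` (the graphs `G−cd`, `G/cd`, `G−cv`, `G/cv` with a free
weight on the other pair at `c`), then `(3PT)` holds for `w`:
`P(a↔b)·P(a↮b) ≤ P(a↔b, a↮c) + P(a↔c, a↮b) + P(b↔c, a↮b)`. [this work] -/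
theorem threePointVariance_twoNeighbour_reduction (w : Sym2 (Fin n) → unitInterval) {a b c v d : Fin n}
    (hac : a ≠ c) (hbc : b ≠ c) (hvc : v ≠ c) (hdc : d ≠ c) (hvd : v ≠ d)
    (hw0 : ∀ x, x ≠ v → x ≠ d → (w s(c, x) : ℝ) = 0)
    (hbd : ∀ (t : unitInterval) (w' : Sym2 (Fin n) → unitInterval),
      (w' = Function.update (Function.update w s(c, v) t) s(c, d) 0 ∨
       w' = Function.update (Function.update w s(c, v) t) s(c, d) 1 ∨
       w' = Function.update (Function.update w s(c, v) 0) s(c, d) t ∨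
       w' = Function.update (Function.update w s(c, v) 1) s(c, d) t) →
      (prodBernoulli w').real (openConn a b) * (prodBernoulli w').real (openConn a b)ᶜ ≤
        (prodBernoulli w').real (openConn a b ∩ (openConn a c)ᶜ) + (prodBernoulli w').real (openConn a c ∩ (openConn a b)ᶜ) +
          (prodBernoulli w').real (openConn b c ∩ (openConn a b)ᶜ)) :
    (prodBernoulli w).real (openConn a b) * (prodBernoulli w).real (openConn a b)ᶜ ≤
      (prodBernoulli w).real (openConn a b ∩ (openConn a c)ᶜ) + (prodBernoulli w).real (openConn a c ∩ (openConn a b)ᶜ) +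
        (prodBernoulli w).real (openConn b c ∩ (openConn a b)ᶜ) := by
  classical
  set e₁ : Sym2 (Fin n) := s(c, v) with he₁
  set e₂ : Sym2 (Fin n) := s(c, d) with he₂
  have he : e₁ ≠ e₂ := by
    intro h
    rw [he₁, he₂, Sym2.eq_iff] at h
    rcases h with ⟨-, h2⟩ | ⟨-, h2⟩
    · exact hvd h2
    · exact hvc h2
  -- the two-parameter family
  set W : unitInterval → unitInterval → (Sym2 (Fin n) → unitInterval) :=
    fun r ρ => Function.update (Function.update w e₁ r) e₂ ρ with hW
  -- its weights at `c`
  have hWoff : ∀ r ρ x, x ≠ v → x ≠ d → (W r ρ s(c, x) : ℝ) = 0 := by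
    intro r ρ x hxv hxd
    have h1 : s(c, x) ≠ e₁ := by
      intro h; rw [he₁, Sym2.eq_iff] at h
      rcases h with ⟨-, h2⟩ | ⟨h1, -⟩
      · exact hxv h2
      · exact hvc h1.symm
    have h2 : s(c, x) ≠ e₂ := by
      intro h; rw [he₂, Sym2.eq_iff] at h
      rcases h with ⟨-, h2⟩ | ⟨h1, -⟩
      · exact hxd h2
      · exact hdc h1.symm
    simp only [hW, Function.update_of_ne h2, Function.update_of_ne h1]
    exact hw0 x hxv hxd
  have hWv : ∀ r ρ, (W r ρ e₁ : ℝ) = r := by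
    intro r ρ; simp only [hW, Function.update_of_ne he, Function.update_self]
  have hWd : ∀ r ρ, (W r ρ e₂ : ℝ) = ρ := by
    intro r ρ; simp only [hW, Function.update_self]
  -- events determined off `c` have the same probability under every `W r ρ`
  have hagree : ∀ r ρ, ∀ e ∈ (↑(pairsOff c) : Set (Sym2 (Fin n))), W r ρ e = w e := by
    intro r ρ e he'
    have hce : c ∉ e := by simpa [pairsOff] using he'
    have h1 : e ≠ e₁ := by intro h; apply hce; rw [h, he₁]; exact Sym2.mem_mk_left c v
    have h2 : e ≠ e₂ := by intro h; apply hce; rw [h, he₂]; exact Sym2.mem_mk_left c d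
    simp only [hW, Function.update_of_ne h2, Function.update_of_ne h1]
  have hsame : ∀ r ρ (X : Set (BondConfig (Fin n))), DeterminedBy X (↑(pairsOff c) : Set (Sym2 (Fin n))) →
      (prodBernoulli (W r ρ)).real X = (prodBernoulli w).real X := by
    intro r ρ X hX
    exact prodBernoulli_real_eq_of_determinedBy (W r ρ) w (hagree r ρ) hX MeasurableSet.of_discrete
  -- the `c`-free events
  set R : Set (BondConfig (Fin n)) := reachOff c a b with hR
  set X' : Set (BondConfig (Fin n)) :=
    ((reachOff c a v ∩ reachOff c b d) ∪ (reachOff c a d ∩ reachOff c b v)) ∩ (reachOff c a b)ᶜ with hX'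
  have hdetR : DeterminedBy R (↑(pairsOff c) : Set (Sym2 (Fin n))) := determinedBy_reachOff a b c
  have hdetX : DeterminedBy X' (↑(pairsOff c) : Set (Sym2 (Fin n))) :=
    (OneLayerTwoFinger.determinedBy_union ((determinedBy_reachOff a v c).inter (determinedBy_reachOff b d c))
      ((determinedBy_reachOff a d c).inter (determinedBy_reachOff b v c))).inter
      (OneLayerTwoFinger.determinedBy_compl (determinedBy_reachOff a b c))
  -- abbreviations for the corner quantities
  set θ₀ : ℝ := (prodBernoulli w).real R with hθ₀
  set πX : ℝ := (prodBernoulli w).real X' with hπX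
  set Th : unitInterval → unitInterval → ℝ := fun r ρ => (prodBernoulli (W r ρ)).real (openConn a b) with hTh
  set Up : unitInterval → unitInterval → ℝ := fun r ρ =>
    (prodBernoulli (W r ρ)).real (openConn a b ∩ (openConn a c)ᶜ) +
      (prodBernoulli (W r ρ)).real (openConn a c ∩ (openConn a b)ᶜ) +
        (prodBernoulli (W r ρ)).real (openConn b c ∩ (openConn a b)ᶜ) with hUp
  -- corner values of `Θ`
  have hTh0 : ∀ r : unitInterval, Th r 0 = θ₀ := by
    intro r
    simp only [hTh]
    rw [real_ab_eq_R (W r 0) hac hbc (hWoff r 0) (by rw [hWd]; rfl), hsame r 0 R hdetR]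
  have hTh0' : ∀ ρ : unitInterval, Th 0 ρ = θ₀ := by
    intro ρ
    simp only [hTh]
    have hw' : ∀ x, x ≠ d → x ≠ v → (W 0 ρ s(c, x) : ℝ) = 0 := fun x hxd hxv => hWoff 0 ρ x hxv hxd
    have h := real_ab_eq_R (v := d) (d := v) (W 0 ρ) hac hbc hw' (by rw [hWv]; rfl)
    rw [h, hsame 0 ρ R hdetR]
  have hTh11_le : Th 1 1 ≤ θ₀ + πX := by
    simp only [hTh]
    have h := real_ab_le_R_add_cross (W 1 1) hac hbc (hWoff 1 1)
    rw [hsame 1 1 R hdetR, hsame 1 1 X' hdetX] at h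
    exact h
  have hTh11_ge : θ₀ ≤ Th 1 1 := by
    simp only [hTh]
    rw [hθ₀, ← hsame 1 1 R hdetR]
    exact measureReal_mono fun ω hω => reachable_of_offC hω
  -- corner values of `Υ`
  have hUp00 : Up 0 0 = θ₀ := by
    simp only [hUp]
    have hall : ∀ x, (W 0 0 s(c, x) : ℝ) = 0 := by
      intro x
      by_cases hxv : x = v
      · subst hxv; rw [← he₁, hWv]; rfl
      · by_cases hxd : x = d
        · subst hxd; rw [← he₂, hWd]; rfl
        · exact hWoff 0 0 x hxv hxd
    have hac0 : (prodBernoulli (W 0 0)).real (openConn a c) = 0 := real_ac_zero (W 0 0) hac hall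
    have hbc0 : (prodBernoulli (W 0 0)).real (openConn b c) = 0 := real_ac_zero (W 0 0) hbc hall
    have h1 : (prodBernoulli (W 0 0)).real (openConn a b ∩ (openConn a c)ᶜ) = (prodBernoulli (W 0 0)).real (openConn a b) := by
      have h := measureReal_inter_add_sdiff (μ := prodBernoulli (W 0 0)) (s := openConn a b) (t := (openConn a c)ᶜ)
        MeasurableSet.of_discrete
      have h' : (prodBernoulli (W 0 0)).real (openConn a b \ (openConn a c)ᶜ) = 0 :=
        le_antisymm ((measureReal_mono (fun ω hω => by simpa using hω.2)).trans (le_of_eq hac0)) measureReal_nonneg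
      linarith
    have h2 : (prodBernoulli (W 0 0)).real (openConn a c ∩ (openConn a b)ᶜ) = 0 :=
      le_antisymm ((measureReal_mono (fun ω hω => hω.1)).trans (le_of_eq hac0)) measureReal_nonneg
    have h3 : (prodBernoulli (W 0 0)).real (openConn b c ∩ (openConn a b)ᶜ) = 0 :=
      le_antisymm ((measureReal_mono (fun ω hω => hω.1)).trans (le_of_eq hbc0)) measureReal_nonneg
    rw [h1, h2, h3, add_zero, add_zero]
    have h := hTh0 0
    simp only [hTh] at h
    exact h
  have hUp10_ge : πX ≤ Up 1 0 := by
    simp only [hUp]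
    have h := real_cross_le_cells (W 1 0) hac hbc hvc (hWoff 1 0) (by rw [hWv]; rfl) (by rw [hWd]; rfl)
    rw [hsame 1 0 X' hdetX] at h
    linarith [measureReal_nonneg (μ := prodBernoulli (W 1 0)) (s := openConn a b ∩ (openConn a c)ᶜ)]
  -- bilinear forms
  have hThbil : ∀ r ρ : unitInterval, Th r ρ = θ₀ + (Th 1 1 - θ₀) * r * ρ := by
    intro r ρ
    have h := real_bilinear w he r ρ (openConn a b)
    have e00 : (prodBernoulli (W 0 0)).real (openConn a b) = θ₀ := hTh0 0
    have e10 : (prodBernoulli (W 1 0)).real (openConn a b) = θ₀ := hTh0 1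
    have e01 : (prodBernoulli (W 0 1)).real (openConn a b) = θ₀ := hTh0' 1
    simp only [hTh]
    simp only [hW] at e00 e10 e01 ⊢
    rw [h, e00, e10, e01]
    ring
  have hUpbil : ∀ r ρ : unitInterval, Up r ρ =
      θ₀ + (Up 1 0 - θ₀) * r + (Up 0 1 - θ₀) * ρ + (Up 1 1 - Up 1 0 - Up 0 1 + θ₀) * r * ρ := by
    intro r ρ
    have h1 := real_bilinear w he r ρ (openConn a b ∩ (openConn a c)ᶜ)
    have h2 := real_bilinear w he r ρ (openConn a c ∩ (openConn a b)ᶜ)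
    have h3 := real_bilinear w he r ρ (openConn b c ∩ (openConn a b)ᶜ)
    have e00 := hUp00
    simp only [hUp] at e00 ⊢
    simp only [hW] at e00 ⊢
    rw [h1, h2, h3]
    linear_combination (1 - (r:ℝ)) * (1 - (ρ:ℝ)) * e00
  -- the cube polynomial and its properties
  set π₁ : ℝ := Th 1 1 - θ₀ with hπ₁
  set α : ℝ := Up 1 0 - θ₀ with hα
  set β : ℝ := Up 0 1 - θ₀ with hβ
  set γ₂ : ℝ := Up 1 1 - Up 1 0 - Up 0 1 + θ₀ with hγ₂
  have hθ₀0 : 0 ≤ θ₀ := measureReal_nonneg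
  have hπ0 : 0 ≤ π₁ := by rw [hπ₁]; linarith
  have hθπ : θ₀ + π₁ ≤ 1 := by
    rw [hπ₁]
    have : Th 1 1 ≤ 1 := by simp only [hTh]; exact measureReal_le_one
    linarith
  have hαlb : π₁ - θ₀ ≤ α := by rw [hπ₁, hα]; linarith
  set N : ℝ → ℝ → ℝ := fun r ρ => (θ₀ + π₁ * r * ρ) * (1 - (θ₀ + π₁ * r * ρ)) - (θ₀ + α * r + β * ρ + γ₂ * r * ρ) with hN
  -- `N` is minus the `(3PT)` margin along the family
  have hmargin : ∀ r ρ : unitInterval, N r ρ =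
      Th r ρ * (1 - Th r ρ) - Up r ρ := by
    intro r ρ
    rw [hThbil r ρ, hUpbil r ρ]
  have hcompl : ∀ r ρ : unitInterval, (prodBernoulli (W r ρ)).real (openConn a b)ᶜ = 1 - Th r ρ := by
    intro r ρ; simp only [hTh]; exact probReal_compl_eq_one_sub MeasurableSet.of_discrete
  -- boundary hypothesis
  have hbdN : ∀ t ∈ Icc (0:ℝ) 1, N t 0 ≤ 0 ∧ N t 1 ≤ 0 ∧ N 0 t ≤ 0 ∧ N 1 t ≤ 0 := by
    intro t ht
    set tt : unitInterval := ⟨t, ht⟩ with htt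
    have key : ∀ r ρ : unitInterval,
        (prodBernoulli (W r ρ)).real (openConn a b) * (prodBernoulli (W r ρ)).real (openConn a b)ᶜ ≤
          (prodBernoulli (W r ρ)).real (openConn a b ∩ (openConn a c)ᶜ) + (prodBernoulli (W r ρ)).real (openConn a c ∩ (openConn a b)ᶜ) +
            (prodBernoulli (W r ρ)).real (openConn b c ∩ (openConn a b)ᶜ) →
        N r ρ ≤ 0 := by
      intro r ρ h
      rw [hmargin r ρ]
      rw [hcompl r ρ] at h
      simp only [hTh, hUp] at h ⊢
      linarith
    refine ⟨?_, ?_, ?_, ?_⟩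
    · have h := key tt 0 (hbd tt (W tt 0) (Or.inl rfl)); simpa [htt] using h
    · have h := key tt 1 (hbd tt (W tt 1) (Or.inr (Or.inl rfl))); simpa [htt] using h
    · have h := key 0 tt (hbd tt (W 0 tt) (Or.inr (Or.inr (Or.inl rfl)))); simpa [htt] using h
    · have h := key 1 tt (hbd tt (W 1 tt) (Or.inr (Or.inr (Or.inr rfl)))); simpa [htt] using h
  -- maximum principle
  have hfp := fp0_two (θ₀ := θ₀) (π := π₁) (α := α) (β := β) (γ₂ := γ₂) N hθ₀0 hπ0 hθπ hαlb
    (fun r ρ => by simp only [hN]) hbdN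
  -- evaluate at the actual weights
  set r₀ : unitInterval := w e₁ with hr₀
  set ρ₀ : unitInterval := w e₂ with hρ₀
  have hWw : W r₀ ρ₀ = w := by
    simp only [hW, hr₀, hρ₀]
    rw [Function.update_eq_self, Function.update_eq_self]  -- placeholder, fixed below if needed
  have hNle := hfp r₀ r₀.2 ρ₀ ρ₀.2
  rw [hmargin r₀ ρ₀] at hNle
  have hc := hcompl r₀ ρ₀
  simp only [hTh, hUp, hWw] at hNle hc
  rw [hc]
  linarith

end Summit.CriticalPhenomena.PercolationContinuityZ3.Theorems.ThreePointVarianceTwoNeighbourReduction
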